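import Summits.CriticalPhenomena.Ising3DConformalLimit.Theses.PositivityBegetsConformality
import Summits.CriticalPhenomena.Ising3DConformalLimit.Theorems.PositivityBegetsConformalityTwoPointSpherePositivity
import Summits.CriticalPhenomena.Ising3DConformalLimit.Theorems.PositivityBegetsConformalityMoebiusOfInversionPositive
import Summits.CriticalPhenomena.Ising3DConformalLimit.Theorems.PositivityBegetsConformalityInversionPositiveLimitStrata
import Summits.CriticalPhenomena.Ising3DConformalLimit.Theorems.InversionUpgradeNormalised.Negative.AutomaticOrders
import Literature.Probability.LatticeModels.InversionPositivity
import Literature.Probability.LatticeModels.GeneralisedFreeFamily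
import Literature.Probability.LatticeModels.CriticalScalingDimension
import Literature.Barriers.CriticalPhenomena.ScaleCovarianceNotMoebius
import HarnessLib

/-!
# Crux `InversionPositiveLimit` (stmt-CriticalPhenomena-4671): the unitarity bound and the
# load-bearing lattice clause — the POSITIVITY half of the tightness analysis

Route `PositivityBegetsConformality`, sub-problem `Ising3DConformalLimit`; theorem-only file,
`--supports stmt-CriticalPhenomena-4671` (lead c5).  The crux asks that every normalised,
non-degenerate, translation-invariant, scale-covariant pointwise scaling limit `S` of `criticalCorr 3`
be INVERSION POSITIVE with weight `Δ` (`IsInversionPositive Δ S`: all radial Osterwalder–Schrader Gram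
matrices are `Matrix.PosSemidef`).  Over `ℝ` this is symmetry (= inversion covariance, item 1982, the
open problem) PLUS non-negativity of the quadratic form.  The covariance half of the load-bearing
analysis is `Theorems/InversionUpgradeNormalised/Negative/LoadBearingHypotheses.lean`; this file records
what the POSITIVITY half adds, all unconditional:

* `posSemidef_ballMatrix_of_isInversionPositive` — at arities `k ≡ 1` inversion positivity of a family
  whose two-point function is `C‖a − b‖^{−2Δ}` (`C > 0`) IS positive-semidefiniteness of the
  Neeb–Ólafsson ball kernel `(1 − 2⟨x_a,x_b⟩ + ‖x_a‖²‖x_b‖²)^{−Δ}` on the punctured unit ball;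
* **the unitarity bound** `half_le_of_isInversionPositive` / `unitarity_bound`: such a family can be
  inversion positive only if `Δ = 0` or `Δ ≥ 1/2 = (d − 2)/2` (`0 < Δ < 1/2` is excluded by the
  proved Neeb–Ólafsson threshold, item 4676 `twoPointSpherePositivity_proof`; `Δ < 0` by an explicit
  two-point witness `{½e₀, ½e₁}` with coefficients `(1, −1)`); in the tree's vocabulary: a
  non-degenerate, Euclidean-invariant, scale-covariant, inversion-positive family has `Δ = 0 ∨ 1/2 ≤ Δ`;
* **Möbius covariance does not give inversion positivity** (`gff_not_isInversionPositive`,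
  `exists_moebius_gaussian_not_isInversionPositive`): the generalised free family `gffFamily Δ`,
  Möbius covariant for every `Δ`, is NOT inversion positive for `0 < Δ < 1/2` (nor for `Δ < 0`) — so the
  tree's Mack converse `isInversionPositive_of_limit` (covariance ⇒ positivity for Ising₃ limits)
  genuinely consumes the lattice's plane reflection positivity and its window `Δ ≥ 1/2`, and the
  kernel-checked equivalence crux 4671 ⟺ item 1982 (p141302) is an equivalence OVER THE LATTICE
  HYPOTHESES, not a model-blind one;
* **the lattice clause is load-bearing for the crux on both sides of `Δ = 1/2`**
  (`inversionPositiveLimit_false_without_lattice_below`: `narrowFamily (1/4)` — fails by the unitarity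
  bound although Euclidean invariance is thrown in; `…_false_with_generic_lattice`: it is even the
  scale-covariant pointwise limit of its own `ℤ³` sampling; `…_false_without_lattice_in_window`: at
  `Δ = 1/2 + 1/50` inside the rigorous window the barrier witness fails through the covariance half);
* consistency (`crux_hypotheses_clear_unitarity_bound`): every admissible limit of the crux has
  `1/2 ≤ Δ` (infrared bound + Simon–Lieb, `scalingDimension_mem_Icc_holds`), so the unitarity
  obstruction never fires there — the constructive form is the landed `1|1` level
  `inversionGram_arityOne_posSemidef_of_limit` (p148112).

References: K.-H. Neeb, G. Ólafsson, J. Funct. Anal. 266 (2014) §6.2 Prop. 6.2 [NeebOlafsson2014];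
G. Mack, Lecture Notes in Physics 37 (1975) [Mack1975]; P. Di Francesco, P. Mathieu, D. Sénéchal,
*Conformal Field Theory* (1997) §4.3.1 [FrancescoMathieuSenechal1997].  No definitions, no `sorry`.
-/

noncomputable section

namespace Summit.CriticalPhenomena.Ising3DConformalLimit.InversionPositiveLimitNegative

open Literature.Probability.LatticeModels Literature.Barriers.CriticalPhenomena
open Filter Set Function EuclideanGeometry
open scoped Topology RealInnerProductSpace
open Summit.CriticalPhenomena.Ising3DConformalLimit.Theorems (twoPointSpherePositivity_proof)
open Summit.CriticalPhenomena.Ising3DConformalLimit.InversionUpgradeNormalisedNegative (two_point_eq fin_append_one_one)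
open Summit.CriticalPhenomena.Ising3DConformalLimit.PositivityBegetsConformalityInversionPositiveLimit
  (ne_inversion_of_norm_lt_one)
open Summit.CriticalPhenomena.Ising3DConformalLimit.PositivityBegetsConformalityMoebiusOfInversionPositive
  (isInversionCovariant_of_isInversionPositive)

/-! ## The `1|1` level of inversion positivity is the ball kernel -/

/-- **The radial OS Gram matrix at arities `k ≡ 1` of a family with two-point function
`C‖a − b‖^{−2Δ}`** is `C` times the Neeb–Ólafsson ball-kernel matrix
`((1 − 2⟨x_a, x_b⟩ + ‖x_a‖²‖x_b‖²)^{−Δ})_{a,b}` (`‖y‖²‖x − ιy‖² = 1 − 2⟨x,y⟩ + ‖x‖²‖y‖²`).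
[cite: NeebOlafsson2014, §6.2 (proof of Prop. 6.2, display)] -/
theorem inversionGram_arityOne_eq {Δ C : ℝ} {S : CorrFamily 3}
    (hS2 : ∀ a b : EuclideanSpace ℝ (Fin 3), a ≠ b → S 2 ![a, b] = C * ‖a - b‖ ^ (-(2 * Δ)))
    {m : ℕ} (x : Fin m → EuclideanSpace ℝ (Fin 3)) (hx : ∀ a, x a ≠ 0 ∧ ‖x a‖ < 1) :
    inversionGram Δ S (fun _ => 1) (fun a (_ : Fin 1) => x a) =
      C • Matrix.of fun a b : Fin m =>
        (1 - 2 * inner ℝ (x a) (x b) + ‖x a‖ ^ 2 * ‖x b‖ ^ 2) ^ (-Δ) := by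
  ext a b
  rw [inversionGram_apply, Matrix.smul_apply, Matrix.of_apply, smul_eq_mul, Fin.prod_univ_one,
    fin_append_one_one]
  have h2 : S 2 ![x a, inversion 0 1 (x b)] = C * ‖x a - inversion 0 1 (x b)‖ ^ (-(2 * Δ)) :=
    hS2 _ _ (ne_inversion_of_norm_lt_one (hx a).2 (hx b).1 (hx b).2)
  have hball : ‖x b‖ ^ (-(2 * Δ)) * ‖x a - inversion 0 1 (x b)‖ ^ (-(2 * Δ)) =
      (1 - 2 * inner ℝ (x a) (x b) + ‖x a‖ ^ 2 * ‖x b‖ ^ 2) ^ (-Δ) := by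
    rw [ballKernel_eq_inversion_form (2 * Δ) (x a) (hx b).1, ballKernel_apply]
    congr 1
    ring
  calc ‖x b‖ ^ (-(2 * Δ)) * S (1 + 1) ![x a, inversion 0 1 (x b)]
      = ‖x b‖ ^ (-(2 * Δ)) * (C * ‖x a - inversion 0 1 (x b)‖ ^ (-(2 * Δ))) := by rw [← h2]
    _ = C * (‖x b‖ ^ (-(2 * Δ)) * ‖x a - inversion 0 1 (x b)‖ ^ (-(2 * Δ))) := by ring
    _ = C * (1 - 2 * inner ℝ (x a) (x b) + ‖x a‖ ^ 2 * ‖x b‖ ^ 2) ^ (-Δ) := by rw [hball]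

/-- **Inversion positivity contains ball-kernel positivity.** If `S` is inversion positive with
weight `Δ` and `S₂(a, b) = C‖a − b‖^{−2Δ}` off the diagonal with `C > 0`, then every ball-kernel
matrix `((1 − 2⟨x_a, x_b⟩ + ‖x_a‖²‖x_b‖²)^{−Δ})_{a,b}` over a finite family in the punctured open unit
ball of `ℝ³` is positive semidefinite (the crux's matrices at arities `k ≡ 1`, divided by `C`).
[cite: NeebOlafsson2014, §6.2 Prop. 6.2] -/
theorem posSemidef_ballMatrix_of_isInversionPositive {Δ C : ℝ} {S : CorrFamily 3}
    (hC : 0 < C)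
    (hS2 : ∀ a b : EuclideanSpace ℝ (Fin 3), a ≠ b → S 2 ![a, b] = C * ‖a - b‖ ^ (-(2 * Δ)))
    (hIP : IsInversionPositive Δ S) (m : ℕ) (x : Fin m → EuclideanSpace ℝ (Fin 3))
    (hx : ∀ a, x a ≠ 0 ∧ ‖x a‖ < 1) :
    (Matrix.of fun a b : Fin m =>
      (1 - 2 * inner ℝ (x a) (x b) + ‖x a‖ ^ 2 * ‖x b‖ ^ 2) ^ (-Δ)).PosSemidef := by
  have hG := hIP.posSemidef (k := fun _ => 1) (X := fun a (_ : Fin 1) => x a) (fun a _ => hx a)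
    (fun a => Function.injective_of_subsingleton _)
  rw [inversionGram_arityOne_eq hS2 x hx] at hG
  have h := hG.smul (inv_nonneg.2 hC.le)
  rwa [smul_smul, inv_mul_cancel₀ hC.ne', one_smul] at h

/-! ## The unitarity bound `Δ = 0 ∨ Δ ≥ 1/2` -/

/-- **Unitarity bound, positive dimensions.** An inversion-positive family with two-point function
`C‖a − b‖^{−2Δ}`, `C > 0`, `Δ > 0`, has `Δ ≥ 1/2 = (d − 2)/2`: the `1|1` level is the ball kernel,
positive semidefinite on the punctured ball iff `Δ ≥ 1/2` (Neeb–Ólafsson 2014 Prop. 6.2 at `n = 3`,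
`s = 2Δ`, proved in tree; item 4676 `twoPointSpherePositivity_proof`). [cite: NeebOlafsson2014, §6.2 Prop. 6.2] -/
theorem half_le_of_isInversionPositive {Δ C : ℝ} {S : CorrFamily 3} (hΔ : 0 < Δ) (hC : 0 < C)
    (hS2 : ∀ a b : EuclideanSpace ℝ (Fin 3), a ≠ b → S 2 ![a, b] = C * ‖a - b‖ ^ (-(2 * Δ)))
    (hIP : IsInversionPositive Δ S) : 1 / 2 ≤ Δ :=
  (twoPointSpherePositivity_proof Δ hΔ).1 (posSemidef_ballMatrix_of_isInversionPositive hC hS2 hIP)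

/-- Hence NO inversion positivity strictly below the unitarity bound: `0 < Δ < 1/2`. [cite: NeebOlafsson2014, §6.2 Prop. 6.2] -/
theorem not_isInversionPositive_of_lt_half {Δ C : ℝ} {S : CorrFamily 3} (hΔ : 0 < Δ)
    (hΔ' : Δ < 1 / 2) (hC : 0 < C)
    (hS2 : ∀ a b : EuclideanSpace ℝ (Fin 3), a ≠ b → S 2 ![a, b] = C * ‖a - b‖ ^ (-(2 * Δ))) :
    ¬ IsInversionPositive Δ S := fun hIP => by
  linarith [half_le_of_isInversionPositive hΔ hC hS2 hIP]

/-- The ball-kernel entry at two scaled basis vectors of `ℝ³`: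
`(1 − 2⟨a eᵢ, b eⱼ⟩ + ‖a eᵢ‖²‖b eⱼ‖²)^{−Δ} = (1 − 2ab[i = j] + a²b²)^{−Δ}`. [folklore] -/
theorem ballMatrix_entry_single (Δ a b : ℝ) (i j : Fin 3) :
    (1 - 2 * inner ℝ (EuclideanSpace.single i a) (EuclideanSpace.single j b) +
        ‖EuclideanSpace.single i a‖ ^ 2 * ‖(EuclideanSpace.single j b : EuclideanSpace ℝ (Fin 3))‖ ^ 2) ^ (-Δ) =
      (1 - 2 * (if i = j then a * b else 0) + a ^ 2 * b ^ 2) ^ (-Δ) := by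
  have h := ballKernel_single_single (n := 3) (2 * Δ) a b i j
  rw [ballKernel_apply, show -(2 * Δ) / 2 = -Δ by ring] at h
  exact h

/-- **Unitarity bound, negative dimensions.** No family with two-point function `C‖a − b‖^{−2Δ}`,
`C > 0`, `Δ < 0`, is inversion positive: at the two one-point configurations `½e₀`, `½e₁` the
ball-kernel matrix is `[(9/16)^{−Δ}, (17/16)^{−Δ}; (17/16)^{−Δ}, (9/16)^{−Δ}]`, whose quadratic form
at `(1, −1)` is `2(9/16)^{−Δ} − 2(17/16)^{−Δ} < 0` since `−Δ > 0`. [folklore] -/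
theorem not_isInversionPositive_of_neg {Δ C : ℝ} {S : CorrFamily 3} (hΔ : Δ < 0) (hC : 0 < C)
    (hS2 : ∀ a b : EuclideanSpace ℝ (Fin 3), a ≠ b → S 2 ![a, b] = C * ‖a - b‖ ^ (-(2 * Δ))) :
    ¬ IsInversionPositive Δ S := by
  intro hIP
  set x : Fin 2 → EuclideanSpace ℝ (Fin 3) :=
    ![EuclideanSpace.single 0 (1 / 2), EuclideanSpace.single 1 (1 / 2)] with hx
  have hadm : ∀ a, x a ≠ 0 ∧ ‖x a‖ < 1 := by
    intro a
    fin_cases a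
    · refine ⟨fun h => ?_, ?_⟩
      · have := congrArg (fun v : EuclideanSpace ℝ (Fin 3) => v 0) h
        norm_num [hx] at this
      · simp only [hx]
        norm_num
    · refine ⟨fun h => ?_, ?_⟩
      · have := congrArg (fun v : EuclideanSpace ℝ (Fin 3) => v 1) h
        norm_num [hx] at this
      · simp only [hx]
        norm_num
  have hM := posSemidef_ballMatrix_of_isInversionPositive hC hS2 hIP 2 x hadm
  have hQ := sum_mul_nonneg_of_posSemidef hM ![1, -1]
  simp only [Fin.sum_univ_two, Matrix.of_apply, hx, Matrix.cons_val_zero, Matrix.cons_val_one,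
    ballMatrix_entry_single] at hQ
  norm_num at hQ
  -- `hQ : 0 ≤ (9/16)^(-Δ) - (17/16)^(-Δ) - ((17/16)^(-Δ) - (9/16)^(-Δ))` up to normalisation
  have hlt : ((9 : ℝ) / 16) ^ (-Δ) < ((17 : ℝ) / 16) ^ (-Δ) :=
    Real.rpow_lt_rpow (by norm_num) (by norm_num) (by linarith)
  linarith

/-- **The unitarity bound for inversion-positive families** (model-blind, pointwise form of the
radial-quantisation unitarity bound for a scalar of dimension `Δ` in `d = 3`): if `S` is inversion
positive with weight `Δ` and its two-point function is `C‖a − b‖^{−2Δ}` with `C > 0`, then `Δ = 0` or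
`Δ ≥ 1/2`.  (`Δ = 0` is a genuine exception: the family `S_n = 1` on injective configurations is
inversion positive with weight `0`.) [cite: NeebOlafsson2014, §6.2 Prop. 6.2] -/
theorem unitarity_bound_of_two_point {Δ C : ℝ} {S : CorrFamily 3} (hC : 0 < C)
    (hS2 : ∀ a b : EuclideanSpace ℝ (Fin 3), a ≠ b → S 2 ![a, b] = C * ‖a - b‖ ^ (-(2 * Δ)))
    (hIP : IsInversionPositive Δ S) : Δ = 0 ∨ 1 / 2 ≤ Δ := by
  rcases lt_trichotomy Δ 0 with hlt | rfl | hgt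
  · exact absurd hIP (not_isInversionPositive_of_neg hlt hC hS2)
  · exact Or.inl rfl
  · exact Or.inr (half_le_of_isInversionPositive hgt hC hS2 hIP)

/-- **The unitarity bound in the crux's vocabulary.** A non-degenerate, Euclidean-invariant,
scale-covariant family on `ℝ³` that is inversion positive with weight `Δ` has `Δ = 0` or `Δ ≥ 1/2`:
its two-point function is `S₂(0,e₀)·‖a − b‖^{−2Δ}` (`two_point_eq`) with `S₂(0,e₀) > 0`.
[cite: NeebOlafsson2014, §6.2 Prop. 6.2] -/
theorem unitarity_bound {Δ : ℝ} {S : CorrFamily 3} (hnd : IsNondegenerateTwoPoint S)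
    (heuc : IsEuclideanInvariant S) (hsc : IsScaleCovariant Δ S) (hIP : IsInversionPositive Δ S) :
    Δ = 0 ∨ 1 / 2 ≤ Δ :=
  unitarity_bound_of_two_point (C := S 2 ![0, EuclideanSpace.single 0 1])
    (hnd _ (zero_unitVec_mem_nonCoincident one_ne_zero))
    (fun a b hab => by rw [two_point_eq heuc hsc hab, mul_comm]) hIP

/-- Positive-dimension form: non-degenerate + Euclidean + scale covariant + inversion positive with
`Δ > 0` forces `Δ ≥ 1/2`. [cite: NeebOlafsson2014, §6.2 Prop. 6.2] -/
theorem half_le_of_isInversionPositive_of_euclidean {Δ : ℝ} {S : CorrFamily 3} (hΔ : 0 < Δ)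
    (hnd : IsNondegenerateTwoPoint S) (heuc : IsEuclideanInvariant S) (hsc : IsScaleCovariant Δ S)
    (hIP : IsInversionPositive Δ S) : 1 / 2 ≤ Δ :=
  (unitarity_bound hnd heuc hsc hIP).resolve_left hΔ.ne'

/-! ## Möbius covariance does not give inversion positivity (the Gaussian witness) -/

/-- The two-point function of the generalised free family. [cite: FrancescoMathieuSenechal1997, §4.3.1] -/
theorem gffFamily_two_eq (Δ : ℝ) (a b : EuclideanSpace ℝ (Fin 3)) :
    gffFamily Δ 2 ![a, b] = 1 * ‖a - b‖ ^ (-(2 * Δ)) := by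
  rw [one_mul]
  rfl

/-- **The generalised free field below the unitarity bound is not inversion positive**: for
`0 < Δ < 1/2` the Möbius-covariant (`isMoebiusCovariant_gff`), non-degenerate, Gaussian family
`gffFamily Δ` violates inversion positivity at the `1|1` level. [cite: NeebOlafsson2014, §6.2 Prop. 6.2] -/
theorem gff_not_isInversionPositive {Δ : ℝ} (hΔ : 0 < Δ) (hΔ' : Δ < 1 / 2) :
    ¬ IsInversionPositive Δ (gffFamily Δ) :=
  not_isInversionPositive_of_lt_half hΔ hΔ' one_pos fun a b _ => gffFamily_two_eq Δ a b

/-- The same for every negative dimension. [folklore] -/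
theorem gff_not_isInversionPositive_of_neg {Δ : ℝ} (hΔ : Δ < 0) :
    ¬ IsInversionPositive Δ (gffFamily Δ) :=
  not_isInversionPositive_of_neg hΔ one_pos fun a b _ => gffFamily_two_eq Δ a b

/-- **Möbius covariance ⇏ inversion positivity (model-blind).** There is a `Δ > 0` and a
non-degenerate, Möbius-covariant, Gaussian (`U₄ ≡ 0`) family on `ℝ³` that is NOT inversion positive
(`gffFamily (1/4)`).  So the direction "covariance ⇒ positivity" of the kernel-checked equivalence
crux 4671 ⟺ item 1982 (`inversionPositiveLimit_iff_inversionUpgradeNormalised`, Mack's converse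
`isInversionPositive_of_limit`) genuinely consumes the lattice input (plane reflection positivity of
`criticalCorr 3` limits and the window `Δ ≥ 1/2`); contrast the Gaussian LOCUS of the crux, where every
admissible limit IS inversion positive (`stub_gaussianLocusPositive`, p148112). [cite: Mack1975, converse direction (radial OS positivity of conformal OS-positive theories)] -/
theorem exists_moebius_gaussian_not_isInversionPositive :
    ∃ (Δ : ℝ) (S : CorrFamily 3), 0 < Δ ∧ IsNondegenerateTwoPoint S ∧ IsMoebiusCovariant Δ S ∧
      ¬ HasNontrivialU4 S ∧ ¬ IsInversionPositive Δ S :=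
  ⟨1 / 4, gffFamily (1 / 4), by norm_num, isNondegenerateTwoPoint_gff _, isMoebiusCovariant_gff _,
    not_hasNontrivialU4_gff _, gff_not_isInversionPositive (by norm_num) (by norm_num)⟩

/-- In particular inversion positivity is NOT implied by inversion covariance together with
non-degeneracy, Euclidean invariance and scale covariance (all weights `Δ ∈ (0, 1/2)`). [cite: NeebOlafsson2014, §6.2 Prop. 6.2] -/
theorem not_isInversionPositive_of_isInversionCovariant :
    ¬ ∀ (Δ : ℝ) (S : CorrFamily 3), 0 < Δ → IsNondegenerateTwoPoint S → IsEuclideanInvariant S →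
      IsScaleCovariant Δ S → IsInversionCovariant Δ S → IsInversionPositive Δ S := fun h =>
  gff_not_isInversionPositive (Δ := 1 / 4) (by norm_num) (by norm_num)
    (h _ _ (by norm_num) (isNondegenerateTwoPoint_gff _) (isEuclideanInvariant_gff _)
      (isScaleCovariant_gff _) (isInversionCovariant_gff _))

/-! ## The lattice clause of the crux is load-bearing on both sides of `Δ = 1/2` -/

/-- The two-point function of the barrier witness `narrowFamily Δ`. [folklore] -/
theorem narrowFamily_two_eq (Δ : ℝ) (a b : EuclideanSpace ℝ (Fin 3)) :
    ScaleNotMoebius.narrowFamily Δ 2 ![a, b] = 1 * ‖a - b‖ ^ (-(2 * Δ)) := by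
  rw [one_mul, ScaleNotMoebius.narrowFamily_two]
  rfl

/-- **Below the window the lattice clause is load-bearing through POSITIVITY.** The crux with
`HasPointwiseScalingLimit (criticalCorr 3) ρ S` deleted is false — even with full Euclidean invariance
added: `narrowFamily (1/4)` is normalised, non-degenerate, Euclidean invariant and scale covariant with
`Δ = 1/4`, and no such family is inversion positive (unitarity bound). [cite: NeebOlafsson2014, §6.2 Prop. 6.2] -/
theorem inversionPositiveLimit_false_without_lattice_below :
    ¬ ∀ (Δ : ℝ) (S : CorrFamily 3), 0 < Δ → (∀ n z, z ∉ NonCoincident 3 n → S n z = 0) →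
      IsNondegenerateTwoPoint S → IsEuclideanInvariant S → IsScaleCovariant Δ S →
      IsInversionPositive Δ S := fun h =>
  not_isInversionPositive_of_lt_half (Δ := 1 / 4) (by norm_num) (by norm_num) one_pos
    (fun a b _ => narrowFamily_two_eq (1 / 4) a b)
    (h _ _ (by norm_num) (ScaleNotMoebius.narrowFamily_eq_zero_of_not_mem (by norm_num))
      (ScaleNotMoebius.narrowFamily_isNondegenerateTwoPoint _)
      (ScaleNotMoebius.narrowFamily_isEuclideanInvariant _)
      (ScaleNotMoebius.narrowFamily_isScaleCovariant _))

/-- **The crux minus its lattice clause, verbatim, is false** (translation invariance only, any `Δ`,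
as in `InversionPositiveLimit` with the two lattice hypotheses `ρ > 0`, `HasPointwiseScalingLimit …`
removed). [cite: NeebOlafsson2014, §6.2 Prop. 6.2] -/
theorem inversionPositiveLimit_false_without_lattice :
    ¬ ∀ (Δ : ℝ) (S : CorrFamily 3), (∀ n z, z ∉ NonCoincident 3 n → S n z = 0) →
      IsNondegenerateTwoPoint S → IsTranslationInvariant S → IsScaleCovariant Δ S →
      IsInversionPositive Δ S := fun h =>
  inversionPositiveLimit_false_without_lattice_below fun Δ S _ hnorm hnd heuc hsc =>
    h Δ S hnorm hnd heuc.1 hsc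

/-- **"Being a scale-covariant lattice limit" is not the content of the lattice clause**: the crux
with `criticalCorr 3` weakened to an ARBITRARY lattice family `G` is false — `narrowFamily (1/4)` is
the pointwise scaling limit of its own `ℤ³` sampling with `ρ δ = δ^{−1/4} > 0`
(`narrowFamily_hasPointwiseScalingLimit`).  What a proof may use is `criticalCorr 3`-specific: the
infrared bound pinning `Δ ≥ 1/2` and reflection positivity. [cite: NeebOlafsson2014, §6.2 Prop. 6.2] -/
theorem inversionPositiveLimit_false_with_generic_lattice :
    ¬ ∀ (G : LatticeCorrFamily 3) (ρ : ℝ → ℝ) (Δ : ℝ) (S : CorrFamily 3),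
      (∀ δ ∈ Set.Ioc (0:ℝ) 1, 0 < ρ δ) → HasPointwiseScalingLimit G ρ S →
      (∀ n z, z ∉ NonCoincident 3 n → S n z = 0) → IsNondegenerateTwoPoint S →
      IsTranslationInvariant S → IsScaleCovariant Δ S → IsInversionPositive Δ S := fun h =>
  not_isInversionPositive_of_lt_half (Δ := 1 / 4) (by norm_num) (by norm_num) one_pos
    (fun a b _ => narrowFamily_two_eq (1 / 4) a b)
    (h _ (fun δ => δ ^ (-(1 / 4 : ℝ))) (1 / 4) _ (fun δ hδ => Real.rpow_pos_of_pos hδ.1 _)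
      (ScaleNotMoebius.narrowFamily_hasPointwiseScalingLimit (1 / 4))
      (ScaleNotMoebius.narrowFamily_eq_zero_of_not_mem (by norm_num))
      (ScaleNotMoebius.narrowFamily_isNondegenerateTwoPoint _)
      (ScaleNotMoebius.narrowFamily_isTranslationInvariant _)
      (ScaleNotMoebius.narrowFamily_isScaleCovariant _))

/-- **Inside the window the lattice clause is load-bearing through COVARIANCE.** Even restricted to
the rigorous Ising window `1/2 ≤ Δ ≤ 1` and with Euclidean invariance added, the crux minus its
lattice clause is false: the barrier witness `narrowFamily Δ` (`Δ = 1/2 + 1/50 ≈ Δ_σ`) is normalised,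
non-degenerate, Euclidean invariant, scale covariant and NOT inversion covariant
(`narrowFamily_not_isInversionCovariant`), whereas inversion positivity implies inversion covariance
for normalised scale-covariant families (`isInversionCovariant_of_isInversionPositive`, item 4673).
[folklore] -/
theorem inversionPositiveLimit_false_without_lattice_in_window :
    ¬ ∀ (Δ : ℝ) (S : CorrFamily 3), 1 / 2 ≤ Δ → Δ ≤ 1 → (∀ n z, z ∉ NonCoincident 3 n → S n z = 0) →
      IsNondegenerateTwoPoint S → IsEuclideanInvariant S → IsScaleCovariant Δ S →
      IsInversionPositive Δ S := fun h =>
  ScaleNotMoebius.narrowFamily_not_isInversionCovariant (Δ := 1 / 2 + 1 / 50) (by norm_num)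
    (isInversionCovariant_of_isInversionPositive
      (ScaleNotMoebius.narrowFamily_eq_zero_of_not_mem (by norm_num))
      (ScaleNotMoebius.narrowFamily_isScaleCovariant _)
      (h _ _ (by norm_num) (by norm_num) (ScaleNotMoebius.narrowFamily_eq_zero_of_not_mem (by norm_num))
        (ScaleNotMoebius.narrowFamily_isNondegenerateTwoPoint _)
        (ScaleNotMoebius.narrowFamily_isEuclideanInvariant _)
        (ScaleNotMoebius.narrowFamily_isScaleCovariant _)))

/-! ## Consistency: admissible limits clear the unitarity bound -/

/-- **Every admissible limit of the crux clears the unitarity bound**: under the crux hypotheses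
(`ρ > 0` on `(0,1]`, pointwise limit of `criticalCorr 3`, non-degenerate, scale covariant) the window
theorem gives `1/2 ≤ Δ ≤ 1` (infrared bound + Simon–Lieb), so the obstruction of
`not_isInversionPositive_of_lt_half` / `…_of_neg` never applies to an Ising₃ limit — consistent with the
landed `1|1` level of the crux (`inversionGram_arityOne_posSemidef_of_limit`, p148112). [cite: Simon1980, Thm. 1] -/
theorem crux_hypotheses_clear_unitarity_bound {ρ : ℝ → ℝ} {Δ : ℝ} {S : CorrFamily 3}
    (hρ : ∀ δ ∈ Set.Ioc (0:ℝ) 1, 0 < ρ δ) (hlim : HasPointwiseScalingLimit (criticalCorr 3) ρ S)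
    (hnd : IsNondegenerateTwoPoint S) (hsc : IsScaleCovariant Δ S) :
    Δ ≠ 0 ∧ 1 / 2 ≤ Δ ∧ Δ ≤ 1 := by
  have h := scalingDimension_mem_Icc_holds ρ Δ S hlim hsc hnd hρ
  exact ⟨by intro h0; rw [h0] at h; norm_num at h, h.1, h.2⟩

end Summit.CriticalPhenomena.Ising3DConformalLimit.InversionPositiveLimitNegative

end
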